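import Literature.NumberTheory.Sieve.AletheiaZomleferFukshanskyGarcia2020Applications
import Literature.NumberTheory.LFunctions.LogIntegralOffsetProofs
import HarnessLib

/-!
# AZFG 2020, §6.1 discharged: Bateman–Horn ⇒ the prime number theorem for arithmetic progressions

Topic `Literature/NumberTheory/Sieve` (family `parity`, sub-problem `BatemanHorn`). Sibling proof
file of `AletheiaZomleferFukshanskyGarcia2020Applications.lean` (its §7.2 facts are discharged in
the sibling `AletheiaZomleferFukshanskyGarcia2020ApplicationsProofs.lean`); everything here is
PROVED (no named facts, no `sorry`). Source: S. L. Aletheia-Zomlefer, L. Fukshansky, S. R. Garcia,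
*The Bateman–Horn conjecture: heuristics, history, and applications*, Expo. Math. 38 (2020)
430–479 = arXiv:1807.08899, §6.1 (locators as in the parent file: arXiv v4 numbering by
subsection, so the prime number theorem for arithmetic progressions is Theorem 6.1.1 and its
display is (6.1.2)).

* `Literature.NumberTheory.Sieve.primeCountingMod_isEquivalent_of_batemanHorn_holds` — the named
  fact `primeCountingMod_isEquivalent_of_batemanHorn` of the parent file: the Bateman–Horn
  conjecture (the tree's `x/(log x)^k` form `BatemanHornConjecture`) implies
  `π(x; a, b) ∼ Li(x)/φ(a)` for `a ≥ 1`, `gcd(a, b) = 1`, with the tree's residue-class count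
  `ParityWave0.primeCountingMod a b x = #{p ≤ x prime : p ≡ b (mod a)}` and
  `Li = LFunctions.offsetLogIntegral`.

## The proof (as printed in §6.1 of the source)

For `f(t) = at + b`: `ω_f(p) = 1` if `p ∤ a` and `0` if `p ∣ a` (`polyRootCountMod_linear`,
parent file), so `f` is a Bateman–Horn system (`isBatemanHornSystem_linear`: primitive of degree
one, hence irreducible; leading coefficient `a > 0`; `ω_f(p) ≤ 1 < p`) whose constant is
`C(f) = ∏_{p ∣ a} (1 - 1/p)⁻¹ = a/φ(a)` (`hasBatemanHornConst_linear`, parent file; identified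
with the constant produced by the conjecture by uniqueness of the ordered limit). Bateman–Horn gives
`Q(f; x) ∼ (a/φ(a)) x/log x`, and "since `at + b ≤ x ⟺ t ≤ (x - b)/a` we have
`π_{a,b}(x) = Q(f; (x-b)/a) ∼ (a/φ(a)) ((x-b)/a)/log((x-b)/a) ∼ x/(φ(a) log x) ∼ Li(x)/φ(a)`".
Formally: `card_linear_le_primeCountingMod` / `primeCountingMod_le_card_linear` give
`Q(f; ⌊(y-b)/a⌋) ≤ π(y; a, b) ≤ Q(f; ⌊(y-b)/a⌋) + b` (the tree's count also counts the at most
`b` primes `p < b` of the residue class, which are not values `an + b`, `n ≥ 0`);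
`isEquivalent_mul_sub_div` (`a⌊(y-b)/a⌋ ∼ y`) and `isEquivalent_log_sub_div`
(`log ⌊(y-b)/a⌋ ∼ log y`) do the rescaling; `Li(x) ∼ x/log x` (the source's Lemma 2.3.2) is the
tree's `LFunctions.isEquivalent_offsetLogIntegral_holds`; and the `O(1)` discrepancy is `o` of a
main term tending to `+∞`.

## References

* S. L. Aletheia-Zomlefer, L. Fukshansky, S. R. Garcia, *The Bateman–Horn conjecture: heuristics,
  history, and applications*, Expo. Math. 38 (2020) 430–479, §6.1, Theorem 6.1.1 and (6.1.2).
  [AletheiaZomleferFukshanskyGarcia2020]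
* P. T. Bateman, R. A. Horn, *A heuristic asymptotic formula concerning the distribution of prime
  numbers*, Math. Comp. 16 (1962) 363–367.
-/

noncomputable section

open Filter Finset Polynomial Asymptotics
open scoped Topology

namespace Literature.NumberTheory.Sieve

/-- `at + b` is irreducible in `ℤ[t]` for `a ≥ 1`, `gcd(a, b) = 1` (primitive of degree one;
Gauss's lemma). [folklore] -/
theorem irreducible_linear_of_coprime (a b : ℕ) (ha : 0 < a) (hab : a.Coprime b) :
    Irreducible (C (a : ℤ) * X + C (b : ℤ)) := by
  have hprim : (C (a : ℤ) * X + C (b : ℤ)).IsPrimitive := by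
    rw [isPrimitive_iff_isUnit_of_C_dvd]
    intro r hr
    have h0 := (C_dvd_iff_dvd_coeff r _).mp hr 0
    have h1 := (C_dvd_iff_dvd_coeff r _).mp hr 1
    simp [coeff_X] at h0 h1
    exact (Nat.isCoprime_iff_coprime.mpr hab).isUnit_of_dvd' h1 h0
  rw [hprim.irreducible_iff_irreducible_map_fraction_map (K := ℚ)]
  refine irreducible_of_degree_eq_one ?_
  simp only [Polynomial.map_add, Polynomial.map_mul, map_C, map_X]
  have ha' : algebraMap ℤ ℚ (a : ℤ) ≠ 0 := by
    rw [eq_intCast]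
    exact_mod_cast ha.ne'
  exact degree_linear ha'

/-- **§6.1**: the single polynomial `f(t) = at + b` (`a ≥ 1`, `gcd(a, b) = 1`) satisfies the
hypotheses of the Bateman–Horn conjecture: it is irreducible (primitive of degree one), has
positive leading coefficient `a`, and `ω_f(p) ≤ 1 < p` for every prime `p`
(`polyRootCountMod_linear`). [cite: AletheiaZomleferFukshanskyGarcia2020, §6.1 (f(t) = at + b)] -/
theorem isBatemanHornSystem_linear (a b : ℕ) (ha : 0 < a) (hab : a.Coprime b) :
    IsBatemanHornSystem ![C (a : ℤ) * X + C (b : ℤ)] where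
  irreducible i := by
    fin_cases i
    exact irreducible_linear_of_coprime a b ha hab
  leadingCoeff_pos i := by
    fin_cases i
    show 0 < (C (a : ℤ) * X + C (b : ℤ)).leadingCoeff
    rw [leadingCoeff_linear (by exact_mod_cast ha.ne')]
    exact_mod_cast ha
  pairwise_not_associated := Subsingleton.pairwise
  hasNoFixedPrimeDivisor p hp := by
    rw [polyRootCountMod_linear a b hab hp]
    split_ifs
    · exact hp.pos
    · exact hp.one_lt

/-- `Q(at + b; x) = #{n ≤ x : an + b prime}` (`a, b ∈ ℕ`; the positivity condition in `Q` is
automatic). [cite: AletheiaZomleferFukshanskyGarcia2020, §6.1 (Q(f; x) for f = at + b)] -/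
theorem polyPrimeCount_linear (a b x : ℕ) :
    polyPrimeCount ![C (a : ℤ) * X + C (b : ℤ)] x =
      #{n ∈ range (x + 1) | (a * n + b).Prime} := by
  unfold polyPrimeCount
  congr 1
  ext n
  simp only [mem_filter, mem_range, Fin.forall_fin_one, Matrix.cons_val_zero, eval_add, eval_mul,
    eval_C, eval_X]
  have hcast : ((a : ℤ) * n + b) = ((a * n + b : ℕ) : ℤ) := by push_cast; ring
  rw [hcast, Int.toNat_natCast]
  constructor
  · rintro ⟨hn, -, hp⟩
    exact ⟨hn, hp⟩
  · rintro ⟨hn, hp⟩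
    exact ⟨hn, by exact_mod_cast hp.pos, hp⟩

/-- **§6.1** ("`at + b ≤ x ⟺ t ≤ (x - b)/a`", so `π_{a,b}(x) = Q(f; (x-b)/a)`), lower half for
the tree's residue-class count: for `y ≥ b`, `#{n ≤ (y-b)/a : an + b prime} ≤ π(y; a, b)` (the map
`n ↦ an + b` is injective into the primes `p ≤ y`, `p ≡ b (mod a)`).
[cite: AletheiaZomleferFukshanskyGarcia2020, §6.1 (π_{a,b}(x) = Q(f; (x-b)/a))] -/
theorem card_linear_le_primeCountingMod (a b : ℕ) (ha : 0 < a) {y : ℕ} (hy : b ≤ y) :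
    #{n ∈ range ((y - b) / a + 1) | (a * n + b).Prime} ≤
      ParityWave0.primeCountingMod a b y := by
  unfold ParityWave0.primeCountingMod
  refine card_le_card_of_injOn (fun n ↦ a * n + b) ?_ ?_
  · intro n hn
    simp only [coe_filter, Set.mem_setOf_eq, mem_range, Nat.lt_succ_iff] at hn ⊢
    obtain ⟨hn, hprime⟩ := hn
    refine ⟨?_, hprime, ?_⟩
    · have h := (Nat.le_div_iff_mul_le ha).mp hn
      rw [mul_comm] at h
      omega
    · unfold Nat.ModEq
      rw [Nat.mul_add_mod]
  · intro n₁ _ n₂ _ h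
    have h' : a * n₁ = a * n₂ := by simpa using h
    exact Nat.eq_of_mul_eq_mul_left ha h'

/-- Upper half of `π_{a,b}(x) = Q(f; (x-b)/a)` for the residue-class count (which also counts the
at most `b` primes `p < b`, `p ≡ b (mod a)`): `π(y; a, b) ≤ #{n ≤ (y-b)/a : an + b prime} + b`
(every prime `b ≤ p ≤ y`, `p ≡ b (mod a)` is `an + b` with `n = (p - b)/a ≤ (y - b)/a`).
[cite: AletheiaZomleferFukshanskyGarcia2020, §6.1 (π_{a,b}(x) = Q(f; (x-b)/a))] -/
theorem primeCountingMod_le_card_linear (a b y : ℕ) :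
    ParityWave0.primeCountingMod a b y ≤
      #{n ∈ range ((y - b) / a + 1) | (a * n + b).Prime} + b := by
  unfold ParityWave0.primeCountingMod
  set S := {p ∈ range (y + 1) | p.Prime ∧ p ≡ b [MOD a]}
  set T := {n ∈ range ((y - b) / a + 1) | (a * n + b).Prime}
  rw [← card_filter_add_card_filter_not (fun p ↦ b ≤ p) (s := S)]
  refine add_le_add ?_ ?_
  · calc #(S.filter (b ≤ ·)) ≤ #(T.image fun n ↦ a * n + b) := card_le_card ?_
      _ ≤ #T := card_image_le
    intro p hp
    simp only [S, mem_filter, mem_range, Nat.lt_succ_iff] at hp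
    obtain ⟨⟨hpy, hprime, hmod⟩, hbp⟩ := hp
    have hdvd : a ∣ p - b := (Nat.modEq_iff_dvd' hbp).mp hmod.symm
    have hp_eq : a * ((p - b) / a) + b = p := by
      rw [Nat.mul_div_cancel' hdvd, Nat.sub_add_cancel hbp]
    rw [mem_image]
    refine ⟨(p - b) / a, ?_, hp_eq⟩
    simp only [T, mem_filter, mem_range, Nat.lt_succ_iff]
    refine ⟨Nat.div_le_div_right (by omega), ?_⟩
    rwa [hp_eq]
  · calc #(S.filter fun p ↦ ¬b ≤ p) ≤ #(range b) := card_le_card ?_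
      _ = b := card_range b
    intro p hp
    simp only [mem_filter, not_le] at hp
    exact mem_range.mpr hp.2

/-- `(y - b)/a → ∞` along `ℕ` (natural subtraction and division). [folklore] -/
theorem tendsto_sub_div_atTop (a b : ℕ) (ha : 0 < a) :
    Tendsto (fun y : ℕ ↦ (y - b) / a) atTop atTop := by
  refine tendsto_atTop_atTop.mpr fun M ↦ ⟨a * M + b, fun y hy ↦ ?_⟩
  refine (Nat.le_div_iff_mul_le ha).mpr ?_
  rw [mul_comm]
  omega

/-- `a · ⌊(y - b)/a⌋ ∼ y` (the two differ by at most `a + b`): the step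
"`(a/φ(a)) · ((x-b)/a) / log((x-b)/a) ∼ x/(φ(a) log x)`" of §6.1, numerator.
[cite: AletheiaZomleferFukshanskyGarcia2020, §6.1 (derivation of (6.1.2) from Bateman–Horn)] -/
theorem isEquivalent_mul_sub_div (a b : ℕ) (ha : 0 < a) :
    (fun y : ℕ ↦ (a : ℝ) * ((y - b) / a : ℕ)) ~[atTop] fun y : ℕ ↦ (y : ℝ) := by
  have hO : (fun y : ℕ ↦ (a : ℝ) * ((y - b) / a : ℕ) - y) =O[atTop] fun _ ↦ (1 : ℝ) := by
    refine IsBigO.of_bound (a + b) (Eventually.of_forall fun y ↦ ?_)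
    have h1 : a * ((y - b) / a) ≤ y := (Nat.mul_div_le (y - b) a).trans (Nat.sub_le y b)
    have h2 : y ≤ a * ((y - b) / a) + a + b := by
      have := Nat.div_add_mod (y - b) a
      have := Nat.mod_lt (y - b) ha
      omega
    rw [norm_one, mul_one, Real.norm_eq_abs, abs_le]
    constructor
    · have : (y : ℝ) ≤ (a : ℝ) * ((y - b) / a : ℕ) + a + b := by exact_mod_cast h2
      linarith
    · have : (a : ℝ) * ((y - b) / a : ℕ) ≤ y := by exact_mod_cast h1
      linarith
  refine hO.trans_isLittleO ((isLittleO_one_left_iff ℝ).2 ?_)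
  exact tendsto_norm_atTop_atTop.comp tendsto_natCast_atTop_atTop

/-- `log ⌊(y - b)/a⌋ ∼ log y` (the two differ by at most `log 2a` eventually): the step
"`log((x-b)/a) = log(x - b) - log a ∼ log x`" of §6.1, denominator.
[cite: AletheiaZomleferFukshanskyGarcia2020, §6.1 (derivation of (6.1.2) from Bateman–Horn)] -/
theorem isEquivalent_log_sub_div (a b : ℕ) (ha : 0 < a) :
    (fun y : ℕ ↦ Real.log ((y - b) / a : ℕ)) ~[atTop] fun y : ℕ ↦ Real.log y := by
  have hO : (fun y : ℕ ↦ Real.log ((y - b) / a : ℕ) - Real.log y) =O[atTop]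
      fun _ ↦ (1 : ℝ) := by
    refine IsBigO.of_bound (Real.log (2 * a)) ?_
    filter_upwards [eventually_ge_atTop (2 * (a + b) + 1)] with y hy
    have h1 : a * ((y - b) / a) ≤ y := (Nat.mul_div_le (y - b) a).trans (Nat.sub_le y b)
    have h2 : y ≤ a * ((y - b) / a) + a + b := by
      have := Nat.div_add_mod (y - b) a
      have := Nat.mod_lt (y - b) ha
      omega
    have hag : a + b + 1 ≤ a * ((y - b) / a) := by omega
    have hgpos : 0 < (y - b) / a :=
      Nat.pos_of_ne_zero (by intro h; rw [h, mul_zero] at hag; omega)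
    have hy0 : (0 : ℝ) < y := by exact_mod_cast (show 0 < y by omega)
    have hg0 : (0 : ℝ) < ((y - b) / a : ℕ) := by exact_mod_cast hgpos
    have hgy : (((y - b) / a : ℕ) : ℝ) ≤ y := by
      exact_mod_cast (le_mul_of_one_le_left (Nat.zero_le _) ha).trans h1
    have hy2 : (y : ℝ) ≤ 2 * a * ((y - b) / a : ℕ) := by
      have : y ≤ 2 * (a * ((y - b) / a)) := by omega
      calc (y : ℝ) ≤ ((2 * (a * ((y - b) / a)) : ℕ) : ℝ) := by exact_mod_cast this
        _ = 2 * a * ((y - b) / a : ℕ) := by push_cast; ring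
    have ha0 : (0 : ℝ) < a := by exact_mod_cast ha
    have h2a : (0 : ℝ) < 2 * a := by linarith
    have hlog2a : 0 ≤ Real.log (2 * a) := Real.log_nonneg (by
      have : (1 : ℝ) ≤ a := by exact_mod_cast ha
      linarith)
    rw [norm_one, mul_one, Real.norm_eq_abs, abs_le]
    constructor
    · have : Real.log y ≤ Real.log (2 * a) + Real.log ((y - b) / a : ℕ) := by
        rw [← Real.log_mul h2a.ne' hg0.ne']
        exact Real.log_le_log hy0 hy2
      linarith
    · have : Real.log ((y - b) / a : ℕ) ≤ Real.log y := Real.log_le_log hg0 hgy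
      linarith
  refine hO.trans_isLittleO ((isLittleO_one_left_iff ℝ).2 ?_)
  exact tendsto_norm_atTop_atTop.comp (Real.tendsto_log_atTop.comp tendsto_natCast_atTop_atTop)

/-- **§6.1, Theorem 6.1.1 / (6.1.2) from Bateman–Horn, discharged**: Bateman–Horn implies the
prime number theorem for arithmetic progressions, `π(x; a, b) ∼ Li(x)/φ(a)` for `gcd(a, b) = 1`,
`a ≥ 1`. Proof as printed in §6.1: for `f(t) = at + b` one has `ω_f(p) = 1` or `0` according
as `p ∤ a` or `p ∣ a`, so `f` is a Bateman–Horn system (`isBatemanHornSystem_linear`) with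
`C(f) = a/φ(a)` (`hasBatemanHornConst_linear`, by uniqueness of the ordered limit), hence
`Q(f; x) ∼ (a/φ(a)) x/log x`; since `at + b ≤ x ⟺ t ≤ (x-b)/a`,
`π_{a,b}(x) = Q(f; (x-b)/a) + O(1) ∼ (a/φ(a)) · ((x-b)/a)/log((x-b)/a) ∼ x/(φ(a) log x)
 ∼ Li(x)/φ(a)` (the `O(1) ≤ b` accounts for the primes `p < b` in the residue class, which the
tree's `primeCountingMod` counts and `Q` does not; `Li(x) ∼ x/log x` is the source's Lemma 2.3.2,
here `LFunctions.isEquivalent_offsetLogIntegral_holds`).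
[cite: AletheiaZomleferFukshanskyGarcia2020, §6.1 Theorem 6.1.1 (6.1.2), from Bateman–Horn] -/
theorem primeCountingMod_isEquivalent_of_batemanHorn_holds :
    primeCountingMod_isEquivalent_of_batemanHorn := by
  intro hBH a b ha hba
  have hab : a.Coprime b := hba.symm
  have hφ : (0 : ℝ) < Nat.totient a := by exact_mod_cast Nat.totient_pos.mpr ha
  -- Bateman–Horn for `f = at + b`: `Q(f; x) ∼ (a/φ(a)) x / log x`.
  obtain ⟨C', hC', hQ⟩ := hBH 1 _ (isBatemanHornSystem_linear a b ha hab)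
  have hCeq : C' = a / (Nat.totient a : ℝ) :=
    tendsto_nhds_unique hC' (hasBatemanHornConst_linear a b ha hab)
  have hdeg : (C (a : ℤ) * X + C (b : ℤ)).natDegree = 1 :=
    natDegree_linear (by exact_mod_cast ha.ne')
  -- compose with `y ↦ (y - b)/a`
  have hg := tendsto_sub_div_atTop a b ha
  have hQg : (fun y : ℕ ↦ (polyPrimeCount ![C (a : ℤ) * X + C (b : ℤ)] ((y - b) / a) : ℝ))
      ~[atTop] fun y : ℕ ↦
        (a : ℝ) * ((y - b) / a : ℕ) / Real.log ((y - b) / a : ℕ) / (Nat.totient a : ℝ) := by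
    refine (hQ.comp_tendsto hg).congr_right (Eventually.of_forall fun y ↦ ?_)
    simp only [Function.comp_apply, Fin.prod_univ_one, Matrix.cons_val_fin_one, hdeg,
      Fintype.card_fin, pow_one, hCeq, Nat.cast_one, div_one]
    ring
  -- `(a/φ(a)) ((y-b)/a) / log((y-b)/a) ∼ y/(φ(a) log y) ∼ Li(y)/φ(a)`
  have hLi : (fun y : ℕ ↦ (y : ℝ) / Real.log y) ~[atTop]
      fun y : ℕ ↦ LFunctions.offsetLogIntegral y :=
    (LFunctions.isEquivalent_offsetLogIntegral_holds.comp_tendsto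
      tendsto_natCast_atTop_atTop).symm
  have hmain : (fun y : ℕ ↦ (a : ℝ) * ((y - b) / a : ℕ) / Real.log ((y - b) / a : ℕ)) ~[atTop]
      fun y : ℕ ↦ LFunctions.offsetLogIntegral y :=
    ((isEquivalent_mul_sub_div a b ha).div (isEquivalent_log_sub_div a b ha)).trans hLi
  have hv : (fun y : ℕ ↦
      (a : ℝ) * ((y - b) / a : ℕ) / Real.log ((y - b) / a : ℕ) / (Nat.totient a : ℝ)) ~[atTop]
        fun y : ℕ ↦ LFunctions.offsetLogIntegral y / (Nat.totient a : ℝ) :=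
    hmain.div IsEquivalent.refl
  have hQv := hQg.trans hv
  -- the target tends to `+∞`, so the `O(1)` discrepancy `π(y; a, b) - Q(f; (y-b)/a)` is `o` of it
  have hv_top :
      Tendsto (fun y : ℕ ↦ LFunctions.offsetLogIntegral y / (Nat.totient a : ℝ)) atTop atTop :=
    (hLi.div (IsEquivalent.refl (u := fun _ ↦ (Nat.totient a : ℝ)))).tendsto_atTop
      (tendsto_natCast_div_log_atTop.atTop_div_const hφ)
  have hw : (fun y : ℕ ↦ (ParityWave0.primeCountingMod a b y : ℝ) -
      polyPrimeCount ![C (a : ℤ) * X + C (b : ℤ)] ((y - b) / a)) =o[atTop]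
      fun y : ℕ ↦ LFunctions.offsetLogIntegral y / (Nat.totient a : ℝ) := by
    have hO : (fun y : ℕ ↦ (ParityWave0.primeCountingMod a b y : ℝ) -
        polyPrimeCount ![C (a : ℤ) * X + C (b : ℤ)] ((y - b) / a)) =O[atTop]
        fun _ ↦ (1 : ℝ) := by
      refine IsBigO.of_bound b ?_
      filter_upwards [eventually_ge_atTop b] with y hy
      have h1 := card_linear_le_primeCountingMod a b ha hy
      have h2 := primeCountingMod_le_card_linear a b y
      rw [← polyPrimeCount_linear] at h1 h2
      rw [norm_one, mul_one, Real.norm_eq_abs, abs_le]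
      constructor
      · have : ((polyPrimeCount ![C (a : ℤ) * X + C (b : ℤ)] ((y - b) / a) : ℕ) : ℝ) ≤
            ParityWave0.primeCountingMod a b y := by exact_mod_cast h1
        linarith
      · have : (ParityWave0.primeCountingMod a b y : ℝ) ≤
            (polyPrimeCount ![C (a : ℤ) * X + C (b : ℤ)] ((y - b) / a) : ℕ) + b := by
          exact_mod_cast h2
        linarith
    exact hO.trans_isLittleO
      ((isLittleO_one_left_iff ℝ).2 (tendsto_norm_atTop_atTop.comp hv_top))
  refine (hQv.add_isLittleO hw).congr_left (Eventually.of_forall fun y ↦ ?_)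
  simp

end Literature.NumberTheory.Sieve
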